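import Summits.AtomisticToContinuum.BoseEinsteinCondensation.Cruxes.GaussianDominationCan.StrategistSketchS1
import HarnessLib

/-!
# Redirect-strategist r1 sketch — crux `GaussianDominationCan` (stmt-AtomisticToContinuum-9479,
# route `BECThomsonPrinciple`), 2026-08-17

Seat `planner-cstrat-stmt-AtomisticToContinuum-9479-r1-0` (REDIRECT strategist, second opinion after the
gen-1/gen-2 `no-strategy` censuses).  Companion of `STRATEGY-CENSUS.md` (gen 3 = r1) in this directory.
Statements (`def … : Prop`) plus ELEMENTARY placements; nothing here is a line, a stub or an item.

What is typed here (new relative to `StrategistSketch.lean` / `StrategistSketchS1.lean`):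

* §D9 — the **conjunct split of the crux through its numerical-range discriminant**:
  `GaussianDominationCan ⟺ GermBilinear ∧ DiagonalDiscriminant` (up to constants, for exact minimisers of
  bounded truncations; hard cores by `HardCoreReduction`).  `DiagonalDiscriminant` = the crux's square form
  `|⟨η, Λ_k†η⟩|² k̃² ≤ 4π²C (E(η) − E₀)` demanded ONLY of trial states `η ⊥ Ψ₀`; the germ supplies the
  cross terms at `Ψ₀`.  The scalar core of the assembly (`discriminant_core`) and the weakening
  `crux ⇒ diagonal` (`diagonalDiscriminantWith_of_gdCanWith`) are proved; the full assembly over trial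
  states (projection `Φ = αΨ₀ + βη`, first variation of the minimiser, `⟨Ψ₀, Λ†Ψ₀⟩ = 0`) is recorded as
  `SplitD9` and NOT filed — the census (§Decomposition, D9) shows the diagonal leaf contains the germ AT
  THE LOW-LYING EXCITED STATES and is crux-strength.
* §T12 — the shape of the quantum-information bound (Petz monotonicity of the Kubo–Mori metric under the
  partial trace onto the two modes `{0, k}`), recorded as a comment only: it is a positive-temperature
  statement with no `T = 0` content (census §Transfer, T12).

Vocabulary: `Negative.{ProductCalculus,CruxForms}` (`sourceIntegral`, `nsq`, `GDIneq`, `InWindow`,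
`GDCanWith`), `StrategistS1` (`crossIntegral`, `GermBilinearWith`, `GermBilinearTrunc`), the coupling line's
`trunc`.  Units `ħ = 2m = 1`; `k = 2πn/L`, `‖n‖` the SUP norm.
-/

noncomputable section

namespace Summit.AtomisticToContinuum.BoseEinsteinCondensation.Cruxes.GaussianDominationCan.StrategistR1

open MeasureTheory
open scoped ENNReal NNReal ComplexConjugate
open Literature.MathematicalPhysics.QuantumManyBody.BoseGas
open Summit.AtomisticToContinuum.BoseEinsteinCondensation.Theses
open Summit.AtomisticToContinuum.BoseEinsteinCondensation.Theorems.GaussianDominationCan.Negative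
  (GDIneq InWindow GDCanWith gaussianDominationCan_iff sourceIntegral theta phase nsq one_le_norm_intVec)
open Summit.AtomisticToContinuum.BoseEinsteinCondensation.Cruxes.GaussianDominationCan.CouplingMonotoneChord
  (trunc)
open Summit.AtomisticToContinuum.BoseEinsteinCondensation.Cruxes.GaussianDominationCan.StrategistS1
  (crossIntegral GermBilinearWith GermBilinear GermBilinearTrunc)

/-! ## §D9  The conjunct split through the numerical-range discriminant

The crux at fixed data is the positivity of the self-adjoint pencil `Q(s) = (H − E₀) − sA_θ + (4π²C s²/k̃²)·1`
for all `s ≥ 0` and phases `θ`, i.e. (`Negative.forall_gdIneq_iff`) the numerical-range discriminant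
`|⟨Φ, Λ_k†Φ⟩|² k̃² ≤ 4π²C (E(Φ) − E₀)‖Φ‖⁴` for every trial state.  Writing `Φ = αΨ₀ + βη`, `η ⊥ Ψ₀`,
`|α|² + |β|² = 1`, with `Ψ₀` the exact (positive, translation-invariant) minimiser of a bounded potential:
`E(Φ) − E₀ = |β|²(E(η) − E₀)` (first variation) and
`⟨Φ, Λ†Φ⟩ = ᾱβ⟨Ψ₀, Λ†η⟩ + αβ̄⟨η, Λ†Ψ₀⟩ + |β|²⟨η, Λ†η⟩` (`⟨Ψ₀, Λ†Ψ₀⟩ = 0` by momentum).  The cross terms are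
the GERM (`GermBilinear`: `|⟨Ψ₀,Λ†η⟩|² + |⟨η,Λ†Ψ₀⟩|² ≤ (4π²C/k̃²)(E(η) − E₀)`), the last term is the DIAGONAL
leaf below; `discriminant_core` is the arithmetic that glues them (constant `4C + 2C'`). -/

/-- `L²` inner product of two `N`-body functions on the fundamental cell. -/
def inner2 (m : ℕ) (L : ℝ) (ψ η : Config (m + 1) → ℂ) : ℂ :=
  ∫ X in cellN (m + 1) L, conj (ψ X) * η X

/-- **D9 leaf `DiagonalDiscriminant`, constants exposed**: the crux's square form, in the additive
`ℝ≥0∞` shape `E₀ + ((m+1)|I(η)|)²·(‖n‖²/L²)/C ≤ E(η)`, demanded only of trial states `η` that are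
`L²`-orthogonal to an exact minimiser `Ψ`. (For `E(η) = ⊤` it is empty, as the crux is.) -/
def DiagonalDiscriminantWith (ρ₀ C : ℝ) (N₀ : ℕ) (v : ℝ → ℝ≥0∞) (M : ℝ) : Prop :=
  ∀ m : ℕ, N₀ ≤ m + 1 → ∀ L : ℝ, 0 < L → ((m + 1 : ℕ) : ℝ) ≤ ρ₀ * L ^ 3 →
    ∀ n : Fin 3 → ℤ, n ≠ 0 → InWindow M m L n →
      ∀ Ψ : PeriodicTrialState (m + 1) L,
        periodicEnergy v Ψ = periodicGroundStateEnergy v (m + 1) L →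
          ∀ η : PeriodicTrialState (m + 1) L, inner2 m L Ψ.ψ η.ψ = 0 →
            periodicGroundStateEnergy v (m + 1) L +
                ENNReal.ofReal ((((m : ℝ) + 1) * ‖sourceIntegral m L n η.ψ‖) ^ 2 *
                  (‖(fun j => (n j : ℝ))‖ ^ 2 / L ^ 2) / C) ≤
              periodicEnergy v η

/-- **D9 leaf `DiagonalDiscriminant`** (quantified like the crux). -/
def DiagonalDiscriminant : Prop :=
  ∀ v : ℝ → ℝ≥0∞, IsRepulsiveFiniteRange v → ∀ M : ℝ, 0 < M →
    ∃ ρ₀ C : ℝ, 0 < ρ₀ ∧ 0 < C ∧ ∃ N₀ : ℕ, DiagonalDiscriminantWith ρ₀ C N₀ v M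

/-- The diagonal leaf with constants uniform along the bounded truncations `min(v, h)` (the shape in
which `HardCoreReduction` consumes leaves). -/
def DiagonalDiscriminantTrunc : Prop :=
  ∀ v : ℝ → ℝ≥0∞, IsRepulsiveFiniteRange v → ∀ M : ℝ, 0 < M →
    ∃ ρ₀ C : ℝ, 0 < ρ₀ ∧ 0 < C ∧ ∃ N₀ : ℕ, ∀ h : ℝ, 0 < h → DiagonalDiscriminantWith ρ₀ C N₀ (trunc v h) M

/-- **The split D9 (NOT filed)**: germ (cross terms at the minimiser) ∧ diagonal discriminant on `{Ψ₀}^⊥`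
⇒ crux.  Paper assembly: `Φ = αΨ₀ + βη`, first variation of the exact minimiser of the bounded
truncation, `⟨Ψ₀, Λ†Ψ₀⟩ = 0`, `discriminant_core`, `Negative.forall_gdIneq_iff`, then
`gaussianDominationCan_of_truncations` (HardCoreReduction, landed).  Why it is not filed: census §D9 —
the diagonal leaf contains the germ at the first excited states (`η = (Ψ₀′ + ζ)/√2`, `Ψ₀′` the two-phonon
state of sector `0`, `ζ` of sector `k`), hence is crux-strength with no producer. -/
def SplitD9 : Prop :=
  GermBilinearTrunc → DiagonalDiscriminantTrunc → BECThomsonPrinciple.GaussianDominationCan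

/-- **Scalar core of the D9 assembly.**  With `κ = k̃²/(4π²)`-type weight: if the cross amplitude `a`
obeys the germ `a²κ ≤ 2C·G` and the diagonal amplitude `d` obeys `d²κ ≤ C'·G` (`G = E(η) − E₀ ≥ 0`), then
the full amplitude `|α||β|a + |β|²d` of `Φ = αΨ₀ + βη` (`|α|, |β| ≤ 1`) obeys the crux's discriminant with
constant `4C + 2C'` against the excess energy `|β|²G` of `Φ`. [folklore] -/
theorem discriminant_core {α β a d G C C' κ : ℝ} (hα : 0 ≤ α) (hβ : 0 ≤ β) (hα1 : α ≤ 1)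
    (hβ1 : β ≤ 1) (hG : 0 ≤ G) (hC : 0 ≤ C) (hC' : 0 ≤ C') (hκ : 0 ≤ κ)
    (hgerm : a ^ 2 * κ ≤ 2 * C * G) (hdiag : d ^ 2 * κ ≤ C' * G) :
    (α * β * a + β ^ 2 * d) ^ 2 * κ ≤ (4 * C + 2 * C') * (β ^ 2 * G) := by
  -- (x + y)² ≤ 2x² + 2y²
  have h1 : (α * β * a + β ^ 2 * d) ^ 2 ≤ 2 * (α * β * a) ^ 2 + 2 * (β ^ 2 * d) ^ 2 := by
    nlinarith [sq_nonneg (α * β * a - β ^ 2 * d)]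
  have hα2 : α ^ 2 ≤ 1 := by nlinarith
  have hβ2 : β ^ 2 ≤ 1 := by nlinarith
  have hβ2nn : 0 ≤ β ^ 2 := sq_nonneg β
  -- cross part: 2 α²β² a²κ ≤ 2 β² (a²κ) ≤ 4 C β² G
  have h2 : 2 * (α * β * a) ^ 2 * κ ≤ 4 * C * (β ^ 2 * G) := by
    have e : 2 * (α * β * a) ^ 2 * κ = 2 * α ^ 2 * (β ^ 2 * (a ^ 2 * κ)) := by ring
    rw [e]
    have hx : β ^ 2 * (a ^ 2 * κ) ≤ β ^ 2 * (2 * C * G) :=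
      mul_le_mul_of_nonneg_left hgerm hβ2nn
    have hx0 : 0 ≤ β ^ 2 * (2 * C * G) := by positivity
    nlinarith
  -- diagonal part: 2 β⁴ d²κ ≤ 2 β² (d²κ) ≤ 2 C' β² G
  have h3 : 2 * (β ^ 2 * d) ^ 2 * κ ≤ 2 * C' * (β ^ 2 * G) := by
    have e : 2 * (β ^ 2 * d) ^ 2 * κ = 2 * β ^ 2 * (β ^ 2 * (d ^ 2 * κ)) := by ring
    rw [e]
    have hx : β ^ 2 * (d ^ 2 * κ) ≤ β ^ 2 * (C' * G) :=
      mul_le_mul_of_nonneg_left hdiag hβ2nn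
    have hx0 : 0 ≤ β ^ 2 * (C' * G) := by positivity
    nlinarith
  calc (α * β * a + β ^ 2 * d) ^ 2 * κ
      ≤ (2 * (α * β * a) ^ 2 + 2 * (β ^ 2 * d) ^ 2) * κ := mul_le_mul_of_nonneg_right h1 hκ
    _ = 2 * (α * β * a) ^ 2 * κ + 2 * (β ^ 2 * d) ^ 2 * κ := by ring
    _ ≤ 4 * C * (β ^ 2 * G) + 2 * C' * (β ^ 2 * G) := add_le_add h2 h3
    _ = (4 * C + 2 * C') * (β ^ 2 * G) := by ring

/-- From `A + 2t ≤ B + t` in `ℝ≥0∞` with `B` finite, `t` finite: `A + t ≤ B`. [folklore] -/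
theorem add_le_of_add_two_le {A B t : ℝ≥0∞} (ht : t ≠ ⊤) (h : A + (t + t) ≤ B + t) :
    A + t ≤ B := by
  have h' : A + t + t ≤ B + t := by simpa [add_assoc] using h
  exact (ENNReal.add_le_add_iff_right ht).1 h'

/-- **The diagonal leaf is a weakening of the crux** (same constants): restrict the chord to `η ⊥ Ψ₀` and
minimise over `s` (`s = b/c`, `b = (m+1)|I|`, `c = C L²/‖n‖²`). [folklore] -/
theorem diagonalDiscriminantWith_of_gdCanWith {ρ₀ C : ℝ} {N₀ : ℕ} {v : ℝ → ℝ≥0∞} {M : ℝ}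
    (hC : 0 < C) (h : GDCanWith ρ₀ C N₀ v M) : DiagonalDiscriminantWith ρ₀ C N₀ v M := by
  intro m hm L hL hd n hn hw Ψ _hΨ η _hη
  set b : ℝ := ((m : ℝ) + 1) * ‖sourceIntegral m L n η.ψ‖ with hbdef
  set c : ℝ := C * L ^ 2 / ‖(fun j => (n j : ℝ))‖ ^ 2 with hcdef
  have hnorm : 0 < ‖(fun j => (n j : ℝ))‖ := lt_of_lt_of_le one_pos (one_le_norm_intVec hn)
  have hc : 0 < c := by positivity
  have hb : 0 ≤ b := by positivity
  by_cases htop : periodicEnergy v η = ⊤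
  · rw [htop]; exact le_top
  have hG := h m hm L hL hd n hn hw (b / c) (div_nonneg hb hc.le) η
  unfold GDIneq at hG
  -- rewrite both real arguments
  have e1 : b / c * (2 * ((m : ℝ) + 1) * ‖sourceIntegral m L n η.ψ‖) = b ^ 2 / c + b ^ 2 / c := by
    rw [hbdef]; field_simp; ring
  have e2 : C * (b / c) ^ 2 * L ^ 2 / ‖(fun j => (n j : ℝ))‖ ^ 2 = b ^ 2 / c := by
    rw [hcdef]; field_simp
  have e3 : (((m : ℝ) + 1) * ‖sourceIntegral m L n η.ψ‖) ^ 2 *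
      (‖(fun j => (n j : ℝ))‖ ^ 2 / L ^ 2) / C = b ^ 2 / c := by
    rw [hbdef, hcdef]; field_simp
  rw [e2] at hG
  have hG' : periodicGroundStateEnergy v (m + 1) L +
      (ENNReal.ofReal (b ^ 2 / c) + ENNReal.ofReal (b ^ 2 / c)) ≤
        periodicEnergy v η + ENNReal.ofReal (b ^ 2 / c) := by
    have hx : 0 ≤ b ^ 2 / c := by positivity
    rw [← ENNReal.ofReal_add hx hx, ← e1]
    convert hG using 3
  rw [e3]
  exact add_le_of_add_two_le ENNReal.ofReal_ne_top hG'

/-! ## §T12  (comment only) the Kubo–Mori monotonicity bound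

For `β < ∞` and `A = B ⊗ 1` supported on the two modes `{0, k}` (`B = Λ_k + Λ_k†` on `F_{0,k}`), Petz
monotonicity of the Kubo–Mori metric under the partial trace `Φ = Tr_{modes ≠ 0,k}` dualises to
`χ_β(A) = β·⟨A, A⟩_{KM, ρ_β} ≤ β·⟨B, B⟩_{KM, Φ(ρ_β)}` — a rigorous UPPER bound on a static susceptibility
with no gap and no reflection positivity.  It has no `T = 0` content: `Φ(ρ_β) → Φ(|Ψ₀⟩⟨Ψ₀|)` is mixed
(depletion-number fluctuations), its Kubo–Mori form of `B` is `O(1 + n_k) > 0`, and the right side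
diverges like `β` while `χ_β(A) → χ_Λ = O(1/k²)`.  Nothing to type. -/

end Summit.AtomisticToContinuum.BoseEinsteinCondensation.Cruxes.GaussianDominationCan.StrategistR1

end
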